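import Summits.QuantumFields.YangMills.Theorems.BalabanUVNodesN15PerCubeGreenSopCoarseGeometry
import HarnessLib

/-!
# N15 = NE2, road (c) — PROGRAMME (PC), (PC-D) «the per-cube LANDAU LETTER», V: THE FAR ZONE OF A CUBE AND THE THREE-COLLAR WALK-LOCALITY BOX — n15-c∕299b's `exists_farZone` with
# the near clause for the boxes `c(2w+2, k) + [0, 6w+5)^{d+1}` on which n15-c∕305∕307∕310 ask the (3.35) data, inside the box `c(Lw + 3w − m₀, k₀) + [0, Lw + 10w + 2)^{d+1}`
# (dag-n15-c g29, n15-c∕309)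

Cell `pub-ymgap`, seat `pub-ymgap-dag-n15-c` (generation g29; R134 (a), s1; HUMAN RULING D-0062).  `bears_on: R4∕N15 · K3⁸ SpineGivenEndpointR13SepCoPHV (stmt-QuantumFields-27366)`;
filed `--kind proof --supports stmt-QuantumFields-27366 --as helper` — COUNT-NEUTRAL.  One theorem, 0 `def`, 0 `sorry`; elementary (`ZMod` bookkeeping).  The proof is n15-c∕299b's
VERBATIM with the window numerals `m₂ = 2w + 2`, `A = 6w + 5`, `m_B = Lw + 3w − m₀` (so `A + B + C − 2 = Lw + 10w + 2`, a proper window of the torus `2Lw` for `L ≥ 11`, `w ≥ 2`).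
Imports n15-c∕299b `…PerCubeGreenSopCoarseGeometry` (`exists_distMinorant`, `val_sub_corner_lt`, `scH_up`; through it FILE 66∕72∕119's cover).  Nothing in the tree is modified.

WHY ((PC-D), HOME `PCD-DESIGN-g28.md`).  The raw Landau letter n15-c∕310 reads the (3.35)-smallness of the cube's gauged field on the THREE-collar boxes `c(2w+2,k)+[0,6w+5)` of the near
cubes (entry 2's closeness n15-c∕305 needs one collar more than entry 0's); the per-cube packaging (n15-c∕311) therefore needs n15-c∕299b's near clause one collar wider, which costs the
locality box two sites (`Lw + 10w + 2` from the corner offset `Lw + 3w − m₀`) and the mild `w = L^m ≥ 2`.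

WHAT.  ★★ `exists_farZone₂`: for every cube `k₀` (`L ≥ 11`, `L^m ≥ 2`) there are `Z ⊆ 𝕋`, `d_Z` with (i) `d_Z ≤ dist(·, Z)` on `Z`, (ii) `0 ≤ d_Z`, Lipschitz, (iii) `d_Z(B(x)) ≥ w` on
`supp h_{k₀}`, (iv) `cvSk k ⊄ Z ⟹ {x | B(x) ∈ c(2w+2,k)+[0,6w+5)} ⊆ {x | B(x) ∈ c(Lw+3w−m₀,k₀)+[0,Lw+10w+2)}`.

HONEST FRAMING ∕ LIMITS.  Elementary geometry of the MODEL cover; [B9] (3.87) p.409, (3.95)–(3.96) p.411, Cor. 3.8 p.410 cited for SHAPES ∕ MECHANISM only.  NE2⁺ NOT PRINTED, NOT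
proved; N15 of record untouched; K3⁸ OPEN; counts UNMOVED.  Restate-immune (no Theses import).
-/

noncomputable section

open scoped BigOperators

namespace Summit.QuantumFields.YangMills.BalabanUVNodes.N15.Gluing

open Real
open Literature.MathematicalPhysics.QuantumFieldTheory.Balaban1983to89
open Literature.MathematicalPhysics.QuantumFieldTheory.Balaban1983to89.B5Prop11Plancherel (Tor fine unitVec)
open Literature.MathematicalPhysics.QuantumFieldTheory.Balaban1983to89.B5Block118 (up bpt)
open Literature.MathematicalPhysics.QuantumFieldTheory.Balaban1983to89.B6UnitTorusCarrier (unitTorusGeo)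
open Literature.MathematicalPhysics.QuantumFieldTheory.King1986.Torus (blockOf val_blockOf tdistT tdistT_nonneg tdistT_symm tdistT_self tdistT_triangle)
open Summit.QuantumFields.YangMills.BalabanUVNodes.N15.TwoGrid (cubeBlocks mem_cubeBlocks)

variable {d : ℕ}

section Cover

variable {L : ℕ} [NeZero L]

/-- ★★ **THE FAR ZONE OF A CUBE AND THE THREE-COLLAR WALK-LOCALITY BOX** (`L ≥ 11`, `w = L^m ≥ 2`): for every cube `k₀` of n15-c∕262's cover there are `Z ⊆ 𝕋` and `d_Z : 𝕋 → ℝ`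
with (i) `d_Z(y) ≤ |y − z|_T` on `Z`, (ii) `0 ≤ d_Z`, `d_Z(y) ≤ |y − z|_T + d_Z(z)`, (iii) `d_Z(B(x)) ≥ w` whenever `h_{k₀}(x) ≠ 0`, and (iv) every cube `k` whose region `cvSk k` is NOT
inside `Z` has its three-collar box `{x | B(x) ∈ c(2w+2, k) + [0, 6w+5)}` inside the box `{x | B(x) ∈ c(Lw + 3w − m₀, k₀) + [0, Lw + 10w + 2)}` (`Z = 𝕋 ∖ (c(w−1, k₀) + [0, 4w−1))`,
FILE 119 `coverGap_le_tdistT`, n15-c∕299b §2's three windows).  The shape of [B9]'s localisation «□̃ ⊃ □» for the random walk (3.87)∕(3.95).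
[cite: Balaban1985BackgroundPropagators, (3.87) p.409, (3.95)–(3.96) p.411, Cor. 3.8 p.410 (shape ∕ mechanism); Balaban1984PropagatorsII, p.239] -/
theorem exists_farZone₂ (hL : Odd L ∧ 1 < L) (hL11 : 11 ≤ L) (mv kk : ℕ) (hW2 : 2 ≤ L ^ mv) (k₀ : Fin (d + 1) → ZMod (2 * L)) :
    ∃ (Z : Set (Tor (cvM d L mv kk hL))) (dZ : Tor (cvM d L mv kk hL) → ℝ),
      (∀ y z, z ∈ Z → dZ y ≤ (unitTorusGeo L kk (cvM d L mv kk hL)).dist y z) ∧ (∀ y, 0 ≤ dZ y) ∧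
      (∀ y z, dZ y ≤ (unitTorusGeo L kk (cvM d L mv kk hL)).dist y z + dZ z) ∧
      (∀ x : ScX d L mv kk hL, scH d L mv kk hL k₀ x ≠ 0 → ((L ^ mv : ℕ) : ℝ) ≤ dZ (blockOf (L ^ kk) (cvM d L mv kk hL) x)) ∧
      (∀ k, ¬ (cvSk d L mv kk hL k ⊆ Z) →
        {x : ScX d L mv kk hL | blockOf (L ^ kk) (cvM d L mv kk hL) x ∈ cubeBlocks (cvM d L mv kk hL) (coverCorner (cvM d L mv kk hL) (L ^ mv) L (2 * L ^ mv + 2) k) (6 * L ^ mv + 5)} ⊆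
        {x : ScX d L mv kk hL | blockOf (L ^ kk) (cvM d L mv kk hL) x ∈ cubeBlocks (cvM d L mv kk hL) (coverCorner (cvM d L mv kk hL) (L ^ mv) L (L * L ^ mv + 3 * L ^ mv - coverMargin L mv) k₀) (L * L ^ mv + 10 * L ^ mv + 2)}) := by
  classical
  have hM : ∀ ν, cvM d L mv kk hL ν = 2 * L * L ^ mv := MP_succ_eq L mv kk hL
  have hw : 0 < L ^ mv := pow_pos (by omega) _
  have hq : 2 ≤ L := by omega
  set BZ : Finset (Tor (cvM d L mv kk hL)) := cubeBlocks (cvM d L mv kk hL) (coverCorner (cvM d L mv kk hL) (L ^ mv) L (L ^ mv - 1) k₀) (4 * L ^ mv - 1) with hBZ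
  set Z : Set (Tor (cvM d L mv kk hL)) := {z | z ∉ BZ} with hZdef
  obtain ⟨dZ, h1, h2, h3, -, h5⟩ := exists_distMinorant (M := cvM d L mv kk hL) Z (c := ((L ^ mv : ℕ) : ℝ)) (Nat.cast_nonneg _)
  refine ⟨Z, dZ, fun y z hz => h1 y z hz, h2, fun y z => h3 y z, fun x hx => ?_, fun k hk => ?_⟩
  · -- (iii): the tail gap of FILE 119
    rw [h5 _ fun z hz => coverGap_le_tdistT hM hw hq hx hz]
  · -- (iv): a witness block in `cvSk k ∩ B_Z(k₀)` and the three windows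
    obtain ⟨y₀, hy₀k, hy₀Z⟩ := Set.not_subset.1 hk
    have hy₀B : y₀ ∈ BZ := by by_contra h; exact hy₀Z h
    intro x hx
    simp only [Set.mem_setOf_eq, mem_cubeBlocks] at hx ⊢
    have hs := (mem_cubeBlocks _).1 (Finset.mem_coe.1 hy₀k)
    have hr := (mem_cubeBlocks _).1 hy₀B
    intro ν
    have hm₀ : coverMargin L mv ≤ L * L ^ mv := by
      unfold coverMargin
      have : (L - 2) * L ^ mv ≤ L * L ^ mv := Nat.mul_le_mul_right _ (Nat.sub_le _ _)
      omega
    have key := val_sub_corner_lt (N := cvM d L mv kk hL ν) (Kk := (L ^ mv : ℤ) * (((k ν).val : ℤ)) - (L ^ mv : ℕ)) (K₀ := (L ^ mv : ℤ) * (((k₀ ν).val : ℤ)) - (L ^ mv : ℕ))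
      (m₂ := 2 * L ^ mv + 2) (mK := coverMargin L mv) (mZ := L ^ mv - 1) (mB := L * L ^ mv + 3 * L ^ mv - coverMargin L mv)
      (A := 6 * L ^ mv + 5) (B := L * L ^ mv) (C := 4 * L ^ mv - 1) (b := blockOf (L ^ kk) (cvM d L mv kk hL) x ν) (y₀ := y₀ ν) ?_ ?_ ?_ (by omega) (by rw [hM ν]; have h11 : 11 * L ^ mv ≤ L * L ^ mv := Nat.mul_le_mul_right _ hL11; have e2 : 2 * L * L ^ mv = 2 * (L * L ^ mv) := (by ring); omega)
    · have e : 6 * L ^ mv + 5 + L * L ^ mv + (4 * L ^ mv - 1) - 2 = L * L ^ mv + 10 * L ^ mv + 2 := by omega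
      rw [e] at key
      convert key using 3
      simp only [coverCorner]; push_cast; ring_nf
    · convert hx ν using 3
      simp only [coverCorner]; push_cast; ring_nf
    · convert hs ν using 3
      simp only [coverCorner]; push_cast; ring_nf
    · convert hr ν using 3
      simp only [coverCorner]; push_cast; ring_nf

end Cover

end Summit.QuantumFields.YangMills.BalabanUVNodes.N15.Gluing

end
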